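import Summits.AtomisticToContinuum.Crystallization.Theorems.GscTwinLoopSurgeryGscHingeGlueMatching
import Summits.AtomisticToContinuum.Crystallization.Theorems.GscTwinLoopSurgeryGscHingeGlueBarlow
import Literature.MathematicalPhysics.StatisticalMechanics.LennardJonesClusters

/-!
# Route `GscTwinLoopSurgery`, support item `GscHingeGlue` (stmt-AtomisticToContinuum-14087): limits of matched sequences

Compactness step of the glue `GscHingeGlue` ("LayeredWindows + re-centring + limit give
`Y ∈ 𝔏` globally `(1/1000)`-matched with `barlowStacking a h s`"):

* `forall_exists_dist_le_of_limits` — if `Xₙ → Y` and `Sₙ → S` in the local matching sense,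
  `Y` is locally finite and `Xₙ`, `Sₙ` are two-way `δ₀`-matched on larger and larger balls,
  then every point of `S` has a point of `Y` within `δ₀` (and symmetrically);
* `barlow_global_match_of_limit` — the case `Sₙ = barlowStacking aₙ hₙ sₙ` with convergent data;
* `exists_subseq_params`, `exists_subseq_haggSeq` — subsequence extraction for the parameters
  `(a, h)` in the closed box `B′` and for `±1` words (pointwise);
* `exists_limit_globally_matched` — **the workhorse**: from `Xₙ ∈ 𝔏` two-way `δ₀`-matched with
  `barlowStacking aₙ hₙ sₙ` on `B(0, R)` for all large `n` (every `R`), a subsequence, a limit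
  `Y ∈ 𝔏` of the `Xₙ`, limit data `(a, h) ∈ B′`, `s`, with `Y` GLOBALLY two-way `δ₀`-matched
  with `barlowStacking a h s`;
* `exists_tail_alternating`, `shift_eq_alternatingHagg` — a `±1` word with at most one wall
  `{m | s (m+1) = s m}` alternates from some `m₁` on (with `s m₁ = 1`), and its shifts by
  `m₁ + 2n` converge pointwise to `alternatingHagg`.

All `[folklore]`; nothing here closes an item.
-/

noncomputable section

open scoped BigOperators Topology
open Filter Set Metric

namespace Summit.AtomisticToContinuum.Crystallization.Theorems.GscHingeGlue

open Literature.MathematicalPhysics.StatisticalMechanics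

/-! ## Global matching from local limits -/

section Generic

variable {E : Type*} [NormedAddCommGroup E]

/-- **Matchings pass to local limits (one direction).** Let `Xₙ → Y` and `Sₙ → S` in the local
matching sense (two-way `ε`-matching on every ball about `0`, eventually, for every `ε > 0`),
let `Y` be locally finite, and let `Xₙ`, `Sₙ` be two-way `δ₀`-matched on the ball of radius `R`
about `0` for all large `n`, for every `R`. Then every point of `S` has a point of `Y` within
`δ₀`. [folklore] -/
theorem forall_exists_dist_le_of_limits {Xs Ss : ℕ → Set E} {Y S : Set E} {δ₀ : ℝ}
    (hYfin : ∀ (p : E) (r : ℝ), (Y ∩ closedBall p r).Finite)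
    (hX : ∀ R ε : ℝ, 0 < ε → ∀ᶠ n in atTop, BallMatch ε R 0 (Xs n) Y)
    (hS : ∀ R ε : ℝ, 0 < ε → ∀ᶠ n in atTop, BallMatch ε R 0 (Ss n) S)
    (hm : ∀ R : ℝ, ∀ᶠ n in atTop, BallMatch δ₀ R 0 (Xs n) (Ss n)) :
    ∀ p ∈ S, ∃ y ∈ Y, dist y p ≤ δ₀ := by
  intro p hp
  obtain ⟨y, hy, hyp⟩ := exists_le_of_forall_pos_exists_le_add (hYfin p (δ₀ + 2))
    (g := fun y => dist y p) (r := δ₀) (fun η hη => by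
      set ε : ℝ := min (η / 2) 1 with hε
      have hε0 : 0 < ε := lt_min (half_pos hη) one_pos
      have hεη : ε ≤ η / 2 := min_le_left _ _
      have hε1 : ε ≤ 1 := min_le_right _ _
      obtain ⟨n, hSn, hmn, hXn⟩ :=
        ((hS ‖p‖ ε hε0).and ((hm (‖p‖ + 1)).and (hX (‖p‖ + δ₀ + 2) ε hε0))).exists
      obtain ⟨p', hp', hp'p⟩ := hSn.1 p hp (by rw [dist_zero_right])
      have hp'0 : dist p' 0 ≤ ‖p‖ + 1 := by
        have := dist_triangle p' p (0 : E)
        simp only [dist_zero_right] at this ⊢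
        linarith
      obtain ⟨x, hx, hxp'⟩ := hmn.1 p' hp' hp'0
      have hx0 : dist x 0 ≤ ‖p‖ + δ₀ + 2 := by
        have := dist_triangle x p' (0 : E)
        linarith
      obtain ⟨y, hy, hxy⟩ := hXn.2 x hx hx0
      have hyp : dist y p ≤ δ₀ + 2 * ε :=
        calc dist y p ≤ dist y x + dist x p' + dist p' p := dist_triangle4 _ _ _ _
          _ ≤ ε + δ₀ + ε := by rw [dist_comm y x]; gcongr
          _ = δ₀ + 2 * ε := by ring
      refine ⟨y, ⟨hy, mem_closedBall.2 (by linarith)⟩, ?_⟩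
      show dist y p ≤ δ₀ + η
      linarith)
  exact ⟨y, hy.1, hyp⟩

end Generic

/-! ## The case of Barlow stackings -/

/-- A Barlow stacking with `a, h > 0` is locally finite. [folklore] -/
theorem finite_barlowStacking_inter_closedBall {a h : ℝ} (ha : 0 < a) (hh : 0 < h)
    (s : ℤ → ℤ) (p : EuclideanSpace ℝ (Fin 3)) (r : ℝ) :
    (barlowStacking a h s ∩ closedBall p r).Finite :=
  finite_of_forall_le_dist_of_subset_closedBall (lt_min ha hh)
    (fun _ hx _ hy hxy => le_dist_of_mem_barlowStacking a h s ha.le hh.le hx.1 hy.1 hxy)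
    inter_subset_right

/-- A `δ`-separated set (`δ > 0`) is locally finite. [folklore] -/
theorem finite_inter_closedBall_of_sep {Y : Set (EuclideanSpace ℝ (Fin 3))} {δ : ℝ} (hδ : 0 < δ)
    (hY : ∀ p ∈ Y, ∀ q ∈ Y, p ≠ q → δ ≤ dist p q) (p : EuclideanSpace ℝ (Fin 3)) (r : ℝ) :
    (Y ∩ closedBall p r).Finite :=
  finite_of_forall_le_dist_of_subset_closedBall hδ
    (fun _ hx _ hy hxy => hY _ hx.1 _ hy.1 hxy) inter_subset_right

/-- **Matchings with convergent stackings pass to the limit.** If `Xₙ → Y` locally, `Y` is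
`δ`-separated, `(aₙ, hₙ) → (a, h)` (all `≥ 1/2`), the `±1` words `sₙ → s` pointwise, and `Xₙ`,
`barlowStacking aₙ hₙ sₙ` are two-way `δ₀`-matched on `B(0, R)` for all large `n` (every `R`),
then `Y` and `barlowStacking a h s` are GLOBALLY two-way `δ₀`-matched. [folklore] -/
theorem barlow_global_match_of_limit {Xs : ℕ → Set (EuclideanSpace ℝ (Fin 3))}
    {Y : Set (EuclideanSpace ℝ (Fin 3))} {δ δ₀ : ℝ} (hδ : 0 < δ)
    (hY : ∀ p ∈ Y, ∀ q ∈ Y, p ≠ q → δ ≤ dist p q)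
    (hX : ∀ R ε : ℝ, 0 < ε → ∀ᶠ n in atTop, BallMatch ε R 0 (Xs n) Y)
    {aseq hseq : ℕ → ℝ} {ss : ℕ → ℤ → ℤ} {a h : ℝ} {s : ℤ → ℤ}
    (ha : Tendsto aseq atTop (𝓝 a)) (hh : Tendsto hseq atTop (𝓝 h))
    (hss : ∀ m : ℤ, ∀ᶠ n in atTop, ss n m = s m) (has : ∀ n, 1 / 2 ≤ aseq n)
    (hhs : ∀ n, 1 / 2 ≤ hseq n) (ha2 : 1 / 2 ≤ a) (hh2 : 1 / 2 ≤ h)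
    (hsn : ∀ n, IsHaggSeq (ss n)) (hs : IsHaggSeq s)
    (hm : ∀ R : ℝ, ∀ᶠ n in atTop,
      BallMatch δ₀ R 0 (Xs n) (barlowStacking (aseq n) (hseq n) (ss n))) :
    (∀ p ∈ barlowStacking a h s, ∃ y ∈ Y, dist y p ≤ δ₀) ∧
      (∀ y ∈ Y, ∃ p ∈ barlowStacking a h s, dist y p ≤ δ₀) := by
  have hS : ∀ R ε : ℝ, 0 < ε → ∀ᶠ n in atTop,
      BallMatch ε R 0 (barlowStacking (aseq n) (hseq n) (ss n)) (barlowStacking a h s) :=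
    fun R ε hε => eventually_ballMatch_barlowStacking ha hh hss has hhs ha2 hh2 hsn hs R ε hε
  refine ⟨forall_exists_dist_le_of_limits (finite_inter_closedBall_of_sep hδ hY) hX hS hm,
    fun y hy => ?_⟩
  have hm' : ∀ R : ℝ, ∀ᶠ n in atTop,
      BallMatch δ₀ R 0 (barlowStacking (aseq n) (hseq n) (ss n)) (Xs n) :=
    fun R => (hm R).mono fun n hn => hn.symm
  obtain ⟨p, hp, hpy⟩ := forall_exists_dist_le_of_limits
    (finite_barlowStacking_inter_closedBall (by linarith) (by linarith) s) hS hX hm' y hy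
  exact ⟨p, hp, by rwa [dist_comm]⟩

/-! ## Subsequence extraction -/

/-- The closed parameter box `B′ = {191/200 ≤ a ≤ 197/200, (81/100) a ≤ h ≤ (329/400) a}` is
compact. [folklore] -/
theorem isCompact_paramBox :
    IsCompact {q : ℝ × ℝ | 191 / 200 ≤ q.1 ∧ q.1 ≤ 197 / 200 ∧ 81 / 100 * q.1 ≤ q.2 ∧
      q.2 ≤ 329 / 400 * q.1} := by
  have hsub : {q : ℝ × ℝ | 191 / 200 ≤ q.1 ∧ q.1 ≤ 197 / 200 ∧ 81 / 100 * q.1 ≤ q.2 ∧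
      q.2 ≤ 329 / 400 * q.1} ⊆ Icc (191 / 200 : ℝ) (197 / 200) ×ˢ Icc (0 : ℝ) 1 := by
    rintro ⟨a, h⟩ ⟨h1, h2, h3, h4⟩
    exact ⟨⟨h1, h2⟩, ⟨by linarith, by linarith⟩⟩
  refine ((isCompact_Icc.prod isCompact_Icc).of_isClosed_subset ?_ hsub)
  refine (isClosed_le continuous_const continuous_fst).inter
    ((isClosed_le continuous_fst continuous_const).inter
      ((isClosed_le (continuous_const.mul continuous_fst) continuous_snd).inter
        (isClosed_le continuous_snd (continuous_const.mul continuous_fst))))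

/-- **Extraction for the parameters**: a sequence in `B′` has a subsequence converging to a
point of `B′`. [folklore] -/
theorem exists_subseq_params {aseq hseq : ℕ → ℝ}
    (hbox : ∀ n, 191 / 200 ≤ aseq n ∧ aseq n ≤ 197 / 200 ∧ 81 / 100 * aseq n ≤ hseq n ∧
      hseq n ≤ 329 / 400 * aseq n) :
    ∃ (φ : ℕ → ℕ) (a h : ℝ), StrictMono φ ∧
      (191 / 200 ≤ a ∧ a ≤ 197 / 200 ∧ 81 / 100 * a ≤ h ∧ h ≤ 329 / 400 * a) ∧
      Tendsto (fun n => aseq (φ n)) atTop (𝓝 a) ∧ Tendsto (fun n => hseq (φ n)) atTop (𝓝 h) := by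
  obtain ⟨⟨a, h⟩, hmem, φ, hφ, hT⟩ :=
    isCompact_paramBox.tendsto_subseq (x := fun n => (aseq n, hseq n)) fun n => hbox n
  exact ⟨φ, a, h, hφ, hmem, (continuous_fst.tendsto _).comp hT, (continuous_snd.tendsto _).comp hT⟩

/-- **Extraction for `±1` words**: a sequence of `±1` words has a pointwise convergent
subsequence (eventually constant at every site), with a `±1` limit. [folklore] -/
theorem exists_subseq_haggSeq {ss : ℕ → ℤ → ℤ} (hss : ∀ n, IsHaggSeq (ss n)) :
    ∃ (φ : ℕ → ℕ) (s : ℤ → ℤ), StrictMono φ ∧ IsHaggSeq s ∧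
      ∀ m : ℤ, ∀ᶠ n in atTop, ss (φ n) m = s m := by
  classical
  let b : ℕ → ℤ → Bool := fun n m => decide (ss n m = 1)
  obtain ⟨L, φ, hφ, hL⟩ := CompactSpace.tendsto_subseq b
  refine ⟨φ, fun m => if L m then 1 else -1, hφ, fun m => by by_cases hm : L m <;> simp [hm],
    fun m => ?_⟩
  have ht : Tendsto (fun n => b (φ n) m) atTop (𝓝 (L m)) := tendsto_pi_nhds.1 hL m
  rw [nhds_discrete Bool, tendsto_pure] at ht
  filter_upwards [ht] with n hn
  by_cases hm : L m
  · rw [hm] at hn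
    simp only [b, decide_eq_true_eq] at hn
    simp [hm, hn]
  · simp only [Bool.not_eq_true] at hm
    rw [hm] at hn
    simp only [b, decide_eq_false_iff_not] at hn
    rcases hss (φ n) m with h1 | h1
    · exact absurd h1 hn
    · simp [hm, h1]

/-- Eventual statements pass to subsequences. [folklore] -/
theorem eventually_subseq {p : ℕ → Prop} {φ : ℕ → ℕ} (hφ : StrictMono φ)
    (h : ∀ᶠ n in atTop, p n) : ∀ᶠ n in atTop, p (φ n) :=
  hφ.tendsto_atTop.eventually h

/-- **The workhorse extraction.** Let `Xₙ ∈ 𝔏` (local limits of translated Lennard-Jones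
ground states in `ℝ³`), `(aₙ, hₙ) ∈ B′`, `sₙ` `±1` words, and suppose `Xₙ` and
`barlowStacking aₙ hₙ sₙ` are two-way `δ₀`-matched on `B(0, R)` for all large `n`, for every
`R`. Then along a subsequence `φ`: the `X_(φ n)` converge locally to some `Y ∈ 𝔏`, the
parameters converge to some `(a, h) ∈ B′`, the words converge pointwise to a `±1` word `s`, and
`Y` is GLOBALLY two-way `δ₀`-matched with `barlowStacking a h s`. (Compactness of uniformly
discrete point sets, of `B′` and of `{±1}^ℤ`; closedness of `𝔏`; uniform minimal distance of
Lennard-Jones ground states.) [folklore] -/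
theorem exists_limit_globally_matched {δ₀ : ℝ}
    {Xs : ℕ → Set (EuclideanSpace ℝ (Fin 3))}
    (hXs : ∀ n, IsLocalLimitOfGroundStates lennardJones 3 (Xs n))
    {aseq hseq : ℕ → ℝ} {ss : ℕ → ℤ → ℤ}
    (hbox : ∀ n, 191 / 200 ≤ aseq n ∧ aseq n ≤ 197 / 200 ∧ 81 / 100 * aseq n ≤ hseq n ∧
      hseq n ≤ 329 / 400 * aseq n)
    (hsn : ∀ n, IsHaggSeq (ss n))
    (hm : ∀ R : ℝ, ∀ᶠ n in atTop,
      BallMatch δ₀ R 0 (Xs n) (barlowStacking (aseq n) (hseq n) (ss n))) :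
    ∃ (φ : ℕ → ℕ) (Y : Set (EuclideanSpace ℝ (Fin 3))) (a h : ℝ) (s : ℤ → ℤ),
      StrictMono φ ∧ IsLocalLimitOfGroundStates lennardJones 3 Y ∧
      (∀ R ε : ℝ, 0 < ε → ∀ᶠ n in atTop, BallMatch ε R 0 (Xs (φ n)) Y) ∧
      (191 / 200 ≤ a ∧ a ≤ 197 / 200 ∧ 81 / 100 * a ≤ h ∧ h ≤ 329 / 400 * a) ∧
      Tendsto (fun n => aseq (φ n)) atTop (𝓝 a) ∧ Tendsto (fun n => hseq (φ n)) atTop (𝓝 h) ∧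
      IsHaggSeq s ∧ (∀ m : ℤ, ∀ᶠ n in atTop, ss (φ n) m = s m) ∧
      (∀ p ∈ barlowStacking a h s, ∃ y ∈ Y, dist y p ≤ δ₀) ∧
      (∀ y ∈ Y, ∃ p ∈ barlowStacking a h s, dist y p ≤ δ₀) := by
  obtain ⟨δ, hδ, hsep⟩ := LennardJonesMinimalDistance_holds
  have hsepX : ∀ n, ∀ p ∈ Xs n, ∀ q ∈ Xs n, p ≠ q → δ ≤ dist p q :=
    fun n p hp q hq hpq => (hXs n).le_dist hsep hp hq hpq
  -- (1) the point sets
  obtain ⟨φ₁, Y, hφ₁, hYsep, hlimY⟩ := exists_subseq_forall_eventually_ballMatch hδ Xs hsepX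
  -- (2) the parameters
  obtain ⟨φ₂, a, h, hφ₂, hab, ha, hh⟩ := exists_subseq_params (fun n => hbox (φ₁ n))
  -- (3) the words
  obtain ⟨φ₃, s, hφ₃, hs, hss⟩ := exists_subseq_haggSeq (fun n => hsn (φ₁ (φ₂ n)))
  have hφ : StrictMono (φ₁ ∘ φ₂ ∘ φ₃) := hφ₁.comp (hφ₂.comp hφ₃)
  have hlim : ∀ R ε : ℝ, 0 < ε → ∀ᶠ n in atTop, BallMatch ε R 0 (Xs (φ₁ (φ₂ (φ₃ n)))) Y :=
    fun R ε hε => eventually_subseq (hφ₂.comp hφ₃) (hlimY R ε hε)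
  have ha' : Tendsto (fun n => aseq (φ₁ (φ₂ (φ₃ n)))) atTop (𝓝 a) := ha.comp hφ₃.tendsto_atTop
  have hh' : Tendsto (fun n => hseq (φ₁ (φ₂ (φ₃ n)))) atTop (𝓝 h) := hh.comp hφ₃.tendsto_atTop
  have hm' : ∀ R : ℝ, ∀ᶠ n in atTop, BallMatch δ₀ R 0 (Xs (φ₁ (φ₂ (φ₃ n))))
      (barlowStacking (aseq (φ₁ (φ₂ (φ₃ n)))) (hseq (φ₁ (φ₂ (φ₃ n)))) (ss (φ₁ (φ₂ (φ₃ n))))) :=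
    fun R => eventually_subseq hφ (hm R)
  have hglob := barlow_global_match_of_limit (Xs := fun n => Xs (φ₁ (φ₂ (φ₃ n)))) hδ hYsep
    hlim ha' hh' hss (fun n => by linarith [(hbox (φ₁ (φ₂ (φ₃ n)))).1])
    (fun n => by
      have := hbox (φ₁ (φ₂ (φ₃ n)))
      nlinarith [this.1, this.2.2.1])
    (by linarith [hab.1]) (by nlinarith [hab.1, hab.2.2.1]) (fun n => hsn _) hs hm'
  refine ⟨φ₁ ∘ φ₂ ∘ φ₃, Y, a, h, s, hφ, ?_, hlim, hab, ha', hh', hs, hss, hglob.1, hglob.2⟩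
  exact IsLocalLimitOfGroundStates.of_eventually_ballMatch (fun n => hXs _) hlim

/-! ## Words with at most one wall -/

/-- **A `±1` word with at most one wall alternates from some layer on**, and one may start at a
layer with `s m₁ = 1`. [folklore] -/
theorem exists_tail_alternating {s : ℤ → ℤ} (hs : IsHaggSeq s)
    (hW : Set.Subsingleton {m : ℤ | s (m + 1) = s m}) :
    ∃ m₁ : ℤ, s m₁ = 1 ∧ ∀ m : ℤ, m₁ ≤ m → s (m + 1) = -s m := by
  -- beyond the (possible) wall, consecutive letters differ
  obtain ⟨m₀, hm₀⟩ : ∃ m₀ : ℤ, ∀ m : ℤ, m₀ ≤ m → s (m + 1) = -s m := by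
    have key : ∀ m : ℤ, m ∉ {m : ℤ | s (m + 1) = s m} → s (m + 1) = -s m := by
      intro m hm
      simp only [mem_setOf_eq] at hm
      rcases hs m with h1 | h1 <;> rcases hs (m + 1) with h2 | h2 <;> omega
    by_cases hne : ∃ w, w ∈ {m : ℤ | s (m + 1) = s m}
    · obtain ⟨w, hw⟩ := hne
      refine ⟨w + 1, fun m hm => key m fun hmW => ?_⟩
      have := hW hmW hw
      omega
    · push Not at hne
      exact ⟨0, fun m _ => key m (hne m)⟩
  rcases hs m₀ with h1 | h1
  · exact ⟨m₀, h1, hm₀⟩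
  · refine ⟨m₀ + 1, by rw [hm₀ m₀ le_rfl, h1]; norm_num, fun m hm => hm₀ m (by omega)⟩

/-- The letters of an alternating tail: `s (m₁ + j) = (-1)^j`. [folklore] -/
theorem apply_add_of_tail_alternating {s : ℤ → ℤ} {m₁ : ℤ} (h1 : s m₁ = 1)
    (halt : ∀ m : ℤ, m₁ ≤ m → s (m + 1) = -s m) (j : ℕ) :
    s (m₁ + j) = if Even j then 1 else -1 := by
  induction j with
  | zero => simpa using h1
  | succ j ih =>
    rw [Nat.cast_succ, ← add_assoc, halt _ (by omega), ih]
    by_cases hj : Even j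
    · have : ¬ Even (j + 1) := by simpa [Nat.even_add_one] using hj
      simp [hj, this]
    · have : Even (j + 1) := by simpa [Nat.even_add_one] using hj
      simp [hj, this]

/-- **Shifting an alternating tail to the origin gives `alternatingHagg`**: if `s` alternates
from `m₁` on with `s m₁ = 1`, then `s (m + (m₁ + 2n)) = alternatingHagg m` for `m ≥ -2n`.
[folklore] -/
theorem shift_eq_alternatingHagg {s : ℤ → ℤ} {m₁ : ℤ} (h1 : s m₁ = 1)
    (halt : ∀ m : ℤ, m₁ ≤ m → s (m + 1) = -s m) (n : ℕ) {m : ℤ} (hm : -(2 * (n : ℤ)) ≤ m) :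
    s (m + (m₁ + 2 * n)) = alternatingHagg m := by
  obtain ⟨j, hj⟩ : ∃ j : ℕ, (j : ℤ) = m + 2 * n := ⟨(m + 2 * n).toNat, Int.toNat_of_nonneg (by omega)⟩
  have e : m + (m₁ + 2 * n) = m₁ + j := by rw [hj]; ring
  rw [e, apply_add_of_tail_alternating h1 halt j, alternatingHagg]
  have hpar : Even j ↔ Even m := by
    have h2 : Even (j : ℤ) ↔ Even m := by
      rw [hj, Int.even_add]
      simp
    rwa [Int.even_coe_nat] at h2
  simp only [hpar]

/-- The shifted tails converge pointwise to `alternatingHagg`. [folklore] -/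
theorem eventually_shift_eq_alternatingHagg {s : ℤ → ℤ} {m₁ : ℤ} (h1 : s m₁ = 1)
    (halt : ∀ m : ℤ, m₁ ≤ m → s (m + 1) = -s m) (m : ℤ) :
    ∀ᶠ n : ℕ in atTop, s (m + (m₁ + 2 * n)) = alternatingHagg m := by
  filter_upwards [eventually_ge_atTop (Int.toNat (-m))] with n hn
  refine shift_eq_alternatingHagg h1 halt n ?_
  have : -m ≤ (n : ℤ) := by
    have := Int.self_le_toNat (-m)
    omega
  omega

end Summit.AtomisticToContinuum.Crystallization.Theorems.GscHingeGlue

end
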